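import Summits.CriticalPhenomena.PercolationContinuityZ3.Theorems.PercNearOneGluingNoHeavyQuantSliceLawSWHolds
import HarnessLib

/-!
# QUANT lane R8, T-DEC, leg (III), blob case — dual route, part 1: the single-layer layer `J(Φ)` of the slice theorem EXPOSED (its defining
# properties, not only its existence), for the reduction `GatedSliceMixLaw → GatedSliceWindowDEC`

builds on p205010 (kernel theorem, internal audit signed; external expert review pending)

Support file (`--supports stmt-CriticalPhenomena-4575`), QUANT lane typer seat prim-quant-stmt (gen 29), rung R8 of
`run/shared/lean/prim/quant/LADDER.md`.  Theorems only, standard axioms, no sorries, no definitions.  Companion of `…QuantGatedSliceWindow`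
(the conjectures `GatedSliceWindowDEC`, `GatedSliceMixLaw`).

WHAT.  Census-2 g55's `sliceSingleLayer_of_midLemmas` (`…QuantSliceSingleLayerReduction`) proves `SliceSingleLayer` — an EXISTENTIAL layer —
from `SliceMidLemmaD`/`SliceMidLemmaW`, both theorems since typer g24's `…QuantSliceLawSWHolds`.  The dual route to the window form of the blob
gate step needs two more facts about THE SAME layer `J` = (largest cheap window atom, else `j′ − a`): a cheapest giant position `q₀` with
`β q₀ ≤ β q` on all giant positions, and **`β q₀ ≤ −Φ(h)` for EVERY atom `h ∈ (J, M]`** (true giants by `slicePullback_trueGiant_expensive`,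
window atoms by non-cheapness).  This file re-runs the construction with these conjuncts exported (`slicePullback_layer`); the proof body is
census-2's, verbatim up to the extra bookkeeping.  Consequence used downstream: at layer `J` the zero atom of the ORIGINAL law can be priced
up to `u·β q₀ ≥ α 0` on every `J`-giant.

* **`LawDec.slicePullback_layer`** — `∃ J q₀`: window bounds, `q₀` cheapest giant, all atoms above `J` carry credit `≥ β q₀`, absorber and low
  conditions of `SliceSingleLayer` at `J`.

[this work]; construction: prim-quant-census-2 g55 (this lane).  The gluing rows served [cite: KozmaNitzan2024, Conjecture 3 (p. 15)]; product
measure [cite: Grimmett1999, §1.3 p. 10].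
-/

noncomputable section

namespace Summit.CriticalPhenomena.PercolationContinuityZ3.Theorems

namespace Quant

open Finset

namespace LawDec

/-- **THE SINGLE-LAYER LAYER, EXPOSED.**  For a slice price system `(α, β)` at `(T + ag, j′)` on `{0..M+a}` (`0 < x < 1`, `x ≤ g ≤ 1`,
`1 ≤ a`, `j′ < M + a`) there are a layer `J` (`j′ − a ≤ J ≤ j′`, `J ≤ M`) and a cheapest giant position `q₀` (`j′+1 ≤ q₀ ≤ M+a`,
`β q₀ ≤ β q` for all giant positions) such that, with `Φ = slicePullback (T+ag) g j′ a α β`: every atom `h` with `J < h ≤ M` has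
`β q₀ ≤ −Φ h`; `Φ h ≤ 0` for every `h ≤ M` that is not a `J`-low of target `T`; and `Φ l ≤ usage x T J l h · (−Φ h)` for every `J`-low `l`
and compatible `h ≤ M`.  (`J` = the largest cheap window atom — `−Φ(h) < β q₀` — if any, else `j′ − a`; census-2 g55's construction with
`sliceMidLemmaD_holds`, `sliceMidLemmaW_holds`.) [this work] -/
theorem slicePullback_layer (x g T : ℝ) (M a j' : ℕ) (α β : ℕ → ℝ)
    (hx0 : 0 < x) (hx1 : x < 1) (hxg : x ≤ g) (hg1 : g ≤ 1) (ha : 1 ≤ a) (hjM : j' < M + a)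
    (hβ : ∀ h, 0 ≤ β h)
    (hαβ : ∀ l h, l ≤ j' → 2 * (l : ℝ) < T + (a : ℝ) * g → h ≤ M + a →
      (j' + 1 ≤ h ∨ T + (a : ℝ) * g < (l : ℝ) + h) → α l ≤ usage x (T + (a : ℝ) * g) j' l h * β h) :
    ∃ J q₀ : ℕ, j' ≤ J + a ∧ J ≤ j' ∧ J ≤ M ∧ j' + 1 ≤ q₀ ∧ q₀ ≤ M + a ∧
      (∀ q, j' + 1 ≤ q → q ≤ M + a → β q₀ ≤ β q) ∧
      (∀ h, J + 1 ≤ h → h ≤ M → β q₀ ≤ - slicePullback (T + (a : ℝ) * g) g j' a α β h) ∧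
      (∀ h, h ≤ M → ¬ (h ≤ J ∧ 2 * (h : ℝ) < T) → slicePullback (T + (a : ℝ) * g) g j' a α β h ≤ 0) ∧
      (∀ l h, l ≤ J → 2 * (l : ℝ) < T → h ≤ M → (J + 1 ≤ h ∨ T < (l : ℝ) + h) →
        slicePullback (T + (a : ℝ) * g) g j' a α β l
          ≤ usage x T J l h * (- slicePullback (T + (a : ℝ) * g) g j' a α β h)) := by
  classical
  have hD : SliceMidLemmaD := sliceMidLemmaD_holds
  have hW : SliceMidLemmaW := sliceMidLemmaW_holds
  set Φ : ℕ → ℝ := slicePullback (T + (a : ℝ) * g) g j' a α β with hΦ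
  -- a cheapest giant position
  have hne : (Finset.Icc (j' + 1) (M + a)).Nonempty := ⟨j' + 1, Finset.mem_Icc.2 ⟨le_rfl, by omega⟩⟩
  obtain ⟨q₀, hq₀mem, hq₀min⟩ := Finset.exists_min_image (Finset.Icc (j' + 1) (M + a)) β hne
  rw [Finset.mem_Icc] at hq₀mem
  have hq₀ : ∀ q, j' + 1 ≤ q → q ≤ M + a → β q₀ ≤ β q := fun q h1 h2 => hq₀min q (Finset.mem_Icc.2 ⟨h1, h2⟩)
  -- the cheap window atoms
  set C : Finset ℕ := (Finset.Icc (j' + 1 - a) (min j' M)).filter (fun h => - Φ h < β q₀) with hC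
  have hCmem : ∀ h, h ∈ C ↔ (j' < h + a ∧ h ≤ j' ∧ h ≤ M) ∧ - Φ h < β q₀ := by
    intro h
    rw [hC, Finset.mem_filter, Finset.mem_Icc]
    constructor
    · rintro ⟨⟨h1, h2⟩, h3⟩
      exact ⟨⟨by omega, le_trans h2 (min_le_left _ _), le_trans h2 (min_le_right _ _)⟩, h3⟩
    · rintro ⟨⟨h1, h2, h3⟩, h4⟩
      exact ⟨⟨by omega, le_min h2 h3⟩, h4⟩
  -- the layer
  let J : ℕ := if hCne : C.Nonempty then C.max' hCne else j' - a
  have hJwin : j' ≤ J + a ∧ J ≤ j' ∧ J ≤ M := by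
    by_cases hCne : C.Nonempty
    · have hJ : J = C.max' hCne := by simp only [J, dif_pos hCne]
      have hm := ((hCmem _).1 (Finset.max'_mem C hCne)).1
      rw [hJ]
      exact ⟨by omega, hm.2.1, hm.2.2⟩
    · have hJ : J = j' - a := by simp only [J, dif_neg hCne]
      rw [hJ]
      omega
  -- window atoms above J are not cheap
  have hnotcheap : ∀ h, J + 1 ≤ h → h ≤ j' → h ≤ M → β q₀ ≤ - Φ h := by
    intro h h1 h2 h3
    by_contra hle
    have hlt : - Φ h < β q₀ := not_le.1 hle
    have hmem : h ∈ C := (hCmem h).2 ⟨⟨by omega, h2, h3⟩, hlt⟩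
    have hCne : C.Nonempty := ⟨h, hmem⟩
    have hJ : J = C.max' hCne := by simp only [J, dif_pos hCne]
    have := Finset.le_max' C h hmem
    omega
  -- if a window atom lies at or below J then J is a cheap window atom
  have hJcheap : ∀ h, h ≤ J → j' < h + a → 0 < h → (J ≤ j' ∧ J ≤ M ∧ j' < J + a) ∧ - Φ J < β q₀ := by
    intro h h1 h2 h0
    by_cases hCne : C.Nonempty
    · have hJ : J = C.max' hCne := by simp only [J, dif_pos hCne]
      have hm := (hCmem _).1 (Finset.max'_mem C hCne)
      rw [hJ]
      exact ⟨⟨hm.1.2.1, hm.1.2.2, hm.1.1⟩, hm.2⟩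
    · have hJ : J = j' - a := by simp only [J, dif_neg hCne]
      exfalso
      omega
  refine ⟨J, q₀, hJwin.1, hJwin.2.1, hJwin.2.2, hq₀mem.1, hq₀mem.2, hq₀, ?_, ?_, ?_⟩
  · -- every atom above J (up to M) carries credit ≥ β q₀
    intro h hJh hhM
    by_cases hg' : j' + 1 ≤ h
    · exact slicePullback_trueGiant_expensive x g T M a j' α β hx0 hxg hg1 h q₀ hg' hhM hq₀
    · exact hnotcheap h hJh (by omega) hhM
  · -- absorber conditions
    intro h hhM hnl
    by_cases hT : T ≤ 2 * (h : ℝ)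
    · exact slicePullback_nonpos_of_absorber x g T M a j' α β hx0 hx1 hxg hg1 ha hβ hαβ h hhM (Or.inl hT)
    · have hJh : J < h := by
        by_contra hle
        exact hnl ⟨not_lt.1 hle, not_le.1 hT⟩
      exact slicePullback_nonpos_of_absorber x g T M a j' α β hx0 hx1 hxg hg1 ha hβ hαβ h hhM (Or.inr (by omega))
  · -- low conditions
    intro l h hlJ hlow hhM hcomp
    have hlh : l < h := by
      rcases hcomp with hc | hc
      · omega
      · have : (l : ℝ) < h := by linarith
        exact_mod_cast this
    have habs : 0 ≤ - Φ h := by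
      have hor : T ≤ 2 * (h : ℝ) ∨ j' < h + a := by
        rcases hcomp with hc | hc
        · right; omega
        · left; linarith
      linarith [slicePullback_nonpos_of_absorber x g T M a j' α β hx0 hx1 hxg hg1 ha hβ hαβ h hhM hor]
    have hupos : 0 < usage x T J l h := usage_pos_of_compat x T J l h hx0 hx1 hlow hlh hcomp
    by_cases hwl : j' < l + a
    · have h0 := slicePullback_windowLow x g T M a j' α β hx0 hx1 hxg hg1 ha hβ hαβ l (by omega) hwl
      have : 0 ≤ usage x T J l h * (- Φ h) := mul_nonneg hupos.le habs
      linarith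
    · have hla : l + a ≤ j' := not_lt.1 hwl
      rcases hcomp with hJh | hmid
      · by_cases hg' : j' + 1 ≤ h
        · exact slicePullback_giant_condition x g T M a j' α β hx0 hx1 hxg hg1 hβ hαβ l h J q₀ hla hlow hq₀mem.1 hq₀mem.2 hJh
            (slicePullback_trueGiant_expensive x g T M a j' α β hx0 hxg hg1 h q₀ hg' hhM hq₀)
        · exact slicePullback_giant_condition x g T M a j' α β hx0 hx1 hxg hg1 hβ hαβ l h J q₀ hla hlow hq₀mem.1 hq₀mem.2 hJh
            (hnotcheap h hJh (by omega) hhM)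
      · by_cases hJh : J + 1 ≤ h
        · by_cases hg' : j' + 1 ≤ h
          · exact slicePullback_giant_condition x g T M a j' α β hx0 hx1 hxg hg1 hβ hαβ l h J q₀ hla hlow hq₀mem.1 hq₀mem.2 hJh
              (slicePullback_trueGiant_expensive x g T M a j' α β hx0 hxg hg1 h q₀ hg' hhM hq₀)
          · exact slicePullback_giant_condition x g T M a j' α β hx0 hx1 hxg hg1 hβ hαβ l h J q₀ hla hlow hq₀mem.1 hq₀mem.2 hJh
              (hnotcheap h hJh (by omega) hhM)
        · have hhJ : h ≤ J := by omega
          have hT2 : T ≤ 2 * (h : ℝ) := by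
            have : (l : ℝ) < h := by exact_mod_cast hlh
            linarith
          by_cases hD' : h + a ≤ j'
          · exact hD x g T M a j' α β hx0 hx1 hxg hg1 ha hjM hβ hαβ l h J hla hlow hhM hD' hT2 hmid hhJ
          · have hwin : j' < h + a := not_le.1 hD'
            obtain ⟨⟨hJ1, hJ2, hJ3⟩, hJc⟩ := hJcheap h hhJ hwin (by omega)
            exact hW x g T M a j' α β hx0 hx1 hxg hg1 ha hjM hβ hαβ q₀ hq₀mem.1 hq₀mem.2 hq₀ J hJ1 hJ2 hJ3 hJc
              l h J hla hlow hhJ hwin hT2 hmid hhJ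

end LawDec

end Quant

end Summit.CriticalPhenomena.PercolationContinuityZ3.Theorems
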